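import Summits.QuantumFields.BalabanUV.T4Continuum.Spine.NE1p.DressedSmallFieldRecordLabelsTorusWitness
import Summits.QuantumFields.BalabanUV.T4Continuum.Spine.NE1p.DressedSmallFieldInnerLabelsRefinedWitnessLive

/-!
# T⁴ programme, spine estimate NE1′ (node O3b/H2) — WITNESS «N0y's RECORD-LABEL ENDs FIRE ON THE NESTED TORI AT ROW NE5's LABEL TYPE —
# BOTH DICTIONARY BRANCHES LIVE», PART 2 (LIVE): the two-term activity at `X₀` in closed form, the attached part AND the μ-part of S53's
# quantities are NOT zero on the datum, and — on the same datum — W71's strict `hmono` for `3 ≤ L`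

Cell `pub-balaban`, sub-cell `t4`, row NE1′ formalisation crew (`t4/formal/NE1p/LEAVES.md` row **W79** ∕ DAG N29zzzzj; INTENT + STAGED
`HOME/CLAIMS.log` l.22901, BOOKED typer gen 8 R-T140 l.23158, X213 its read), unit `b2b-balaban-t4-ne1p-formalise-leaf-05` (gen 12); PART 2
of 2 (D1; PART 1 = p240309 4a042e3009c2) — imports PART 1 `Spine/NE1p/DressedSmallFieldRecordLabelsTorusWitness`
and W71 PART 2 `Spine/NE1p/DressedSmallFieldInnerLabelsRefinedWitnessLive` (leaf-06 g12, p239616 — for `hmono_strict` BY NAME in the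
closing instance) ONLY; THEOREMS ONLY (0 def, 0 `def … : Prop`, 0 cite, 0 sorry); W41's `termAt_coreW_pencil` ∕ `closedForm_real_sub_zero` ∕
`norm_term_le`, W33's `integral_incr_pos`, W24's `exp_locE_cube` ∕ `dressedConst_le_one`, W71's `hmono_strict` BY NAME — nothing restated.

* §4 `actI_X₀` — the activity at `X₀` is the SUM OF TWO closed-form cores (family branch + bond branch), `= (cI labF + cI labB)·∫ e^{s·r·e^{−φ²}}
  e^{−‖v‖²}`; **`actI_live`** (attached: `s = 1` vs `0`) and **`actI_mu_live`** (μ-part: any real source `0 < t`) — both differences are a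
  POSITIVE weight times W33's positive increment integral; `norm_actI_X₀_lt_one` (the two terms together stay inside the unit disc for
  `‖s‖ ≤ 2`: `majI ≤ 1` twice, W41's `norm_term_le`, `A ≤ 1`, `2·√π∕√(2π) = √2 < 2`… precisely `A·√π∕√(2π) < 1`);
  **`recordEnd_live`** ∕ **`recordMuEnd_live`** — S53's two bounded quantities are NOT zero (W24's `exp_locE_cube`); the closing `example`:
  attached bound ∧ μ bound ∧ both livenesses ∧ W71's strict `hmono` (`3 ≤ L`) on ONE datum.

HONEST FRAMING.  A DECIDED TOY, as PART 1: two terms on one polymer over row NE5's TOY frame; (B1b) NOT claimed; (B3-amp) BY CHOICE —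
UNPRINTED for Bałaban's cores (GAPS G-ne9p2-5); `3 ≤ L` is S47's letter (print's «L odd > 11» TYPE only); WHICH tori are Bałaban's =
pv22's READING (D-pv22.3); no numeral of [Balaban1988RGII]; 0 binders instantiated on Bałaban's densities; no wall item; wall WORDING
v1.8 (T4-DAG v48) — words, not kind — does NOT move; R-t4r2-Q2 NOT met; NE1′ ⇐ the named binders — NOT proved, NOT printed; spine PROVED
0∕9; count 9 unchanged.  Rung (B)+1 on ONE finite four-torus — NOT infinite volume, NOT a mass gap, NOT OS on ℝ⁴, NOT Clay.
HONEST DEPENDENCY: continuum YM on T⁴ ⇐ BetaPertH ∧ nine spine estimates (0/9 proved); BetaPertH ⇐ (D1) ∧ (D4) ∧ CAP+tail; G-an2-4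
gates asym, D1 and NE2/3/4.
-/

noncomputable section

namespace Summit.QuantumFields.BalabanUV.T4Continuum.NE1p.DressedSmallFieldRecordLabelsTorusWitness

open Set Metric MeasureTheory Complex
open scoped BigOperators
open Literature.MathematicalPhysics.QuantumFieldTheory.Balaban1983to89.B12TreeDecay (K₀ K₀_pos)
open Literature.MathematicalPhysics.QuantumFieldTheory.Balaban1983to89.B13Resummation (locE)
open Literature.MathematicalPhysics.QuantumFieldTheory.Balaban1983to89.TreeLengthTorus (TPt TDom tsys torusTreeLen)
open Literature.MathematicalPhysics.QuantumFieldTheory.Balaban1983to89.TreeLengthTorusGeometry (tgeometry TTouch)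
open Summit.QuantumFields.BalabanUV.T4Continuum.B13HistMeasurable (B13HistM)
open Summit.QuantumFields.BalabanUV.T4Continuum.B13HistWitness (toyFrame)
open Summit.QuantumFields.BalabanUV.T4Continuum.NE1p.DressedSmallFieldTorusWitness (X₀ X₀_val dressedConst_le_one exp_locE_cube)
open Summit.QuantumFields.BalabanUV.T4Continuum.NE1p.DressedSmallFieldCoresWitness (E1 crd liveTable Acst Acst_pos incr integral_incr_pos)
open Summit.QuantumFields.BalabanUV.T4Continuum.NE1p.DressedSmallFieldCoresMassWitness (cM cM_pos)
open Summit.QuantumFields.BalabanUV.T4Continuum.NE1p.DressedSmallFieldDepCoresWitness (termAt_coreW_pencil closedForm_real_sub_zero norm_term_le)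
open Summit.QuantumFields.BalabanUV.T4Continuum.NE1p.DressedSmallFieldInnerLabelsRefinedWitness (blk hmono_strict)

section Torus
variable (N : ℕ) [NeZero N] (L : ℕ) [NeZero L] (r : ℝ) (hr : 0 ≤ r)

/-! ## §4 LIVE: the two-term activity in closed form; neither of S53's quantities is zero on the datum -/

open Classical in
/-- **THE ACTIVITY AT `X₀` IN CLOSED FORM — TWO TERMS**: family branch + bond branch, each W33's core at its weight (W41's
`termAt_coreW_pencil` BY NAME), collected as `(cI labF + cI labB)·∫ …`. [folklore] -/
theorem actI_X₀ (k : ℕ) (s : ℂ) :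
    actI N L r hr k s (X₀ N) =
      ((cI N L r (labF N L) + cI N L r (labB N L) : ℝ) : ℂ) *
        ∫ v : E1, cexp (s * ((r : ℂ) * (Real.exp (-(crd v ^ 2)) : ℂ))) * cexp (-(((‖v‖ ^ 2 : ℝ) : ℂ))) := by
  unfold actI
  rw [termsI_X₀, Finset.sum_pair (labF_ne_labB N L), GI_apply, GI_apply, termAt_coreW_pencil, termAt_coreW_pencil]
  push_cast
  ring

/-- The total weight of the two terms is positive. [arith] -/
theorem cI_sum_pos : 0 < cI N L r (labF N L) + cI N L r (labB N L) := add_pos (cI_pos N L r _) (cI_pos N L r _)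

/-- **THE μ-PART OF THE ACTIVITY IS NOT ZERO** at any real source `0 < t` (positive total weight × W33's positive increment integral
at `t·r > 0`). [folklore] -/
theorem actI_mu_live (hr0 : 0 < r) {t : ℝ} (ht : 0 < t) (k : ℕ) : actI N L r hr k t (X₀ N) ≠ actI N L r hr k 0 (X₀ N) := by
  intro h
  have h0 := sub_eq_zero.2 h
  rw [actI_X₀, actI_X₀, closedForm_real_sub_zero _ r hr t] at h0
  rcases mul_eq_zero.1 h0 with hc | hI
  · exact (cI_sum_pos N L r).ne' (by exact_mod_cast hc)
  · exact (integral_incr_pos (t * r) (mul_pos ht hr0)).ne' (by exact_mod_cast hI)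

/-- **THE ATTACHED PART OF THE ACTIVITY IS NOT ZERO** (`s = 1` against `0`). [folklore] -/
theorem actI_live (hr0 : 0 < r) (k : ℕ) : actI N L r hr k 1 (X₀ N) ≠ actI N L r hr k 0 (X₀ N) := by
  have h := actI_mu_live N L r hr hr0 one_pos k
  rwa [Complex.ofReal_one] at h

/-- The two terms together stay STRICTLY inside the unit disc for `‖s‖ ≤ 2` (`majI ≤ 1` for both labels, W41's `norm_term_le`, `A ≤ 1`).
[folklore] -/
theorem norm_actI_X₀_lt_one (k : ℕ) {s : ℂ} (hs : ‖s‖ ≤ 2) : ‖actI N L r hr k s (X₀ N)‖ < 1 := by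
  rw [actI_X₀]
  set J : ℂ := ∫ v : E1, cexp (s * ((r : ℂ) * (Real.exp (-(crd v ^ 2)) : ℂ))) * cexp (-(((‖v‖ ^ 2 : ℝ) : ℂ))) with hJ
  have hπ : 0 < Real.sqrt Real.pi := Real.sqrt_pos.2 Real.pi_pos
  have hlt : Real.sqrt Real.pi < Real.sqrt (2 * Real.pi) := Real.sqrt_lt_sqrt Real.pi_pos.le (by linarith [Real.pi_pos])
  have hq : Real.sqrt Real.pi / Real.sqrt (2 * Real.pi) < 1 := (div_lt_one (hπ.trans hlt)).2 hlt
  have hq0 : 0 ≤ Real.sqrt Real.pi / Real.sqrt (2 * Real.pi) := by positivity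
  have hA : Acst ≤ 1 := dressedConst_le_one
  have hA0 := Acst_pos
  have hb := norm_term_le r hr hs
  -- each term: weight = majI ℓ · (cM r / 2), and ‖(cM r/2)·J‖ ≤ (A/2)·(√π/√(2π))
  have hterm : ∀ ℓ : LabelI N L, ‖((cI N L r ℓ : ℝ) : ℂ) * J‖ ≤ Acst / 2 * (Real.sqrt Real.pi / Real.sqrt (2 * Real.pi)) := by
    intro ℓ
    have hp0 : 0 ≤ majI N L ℓ := (majI_pos N L ℓ).le
    have hp1 := majI_le_one N L ℓ
    have hn : ‖((cI N L r ℓ : ℝ) : ℂ) * J‖ = majI N L ℓ * ‖((cM r / 2 : ℝ) : ℂ) * J‖ := by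
      unfold cI
      rw [norm_mul, norm_mul, Complex.norm_real, Complex.norm_real, Real.norm_eq_abs, Real.norm_eq_abs, abs_mul, abs_of_nonneg hp0]
      ring
    rw [hn]
    calc majI N L ℓ * ‖((cM r / 2 : ℝ) : ℂ) * J‖ ≤ 1 * (Acst / 2 * (Real.sqrt Real.pi / Real.sqrt (2 * Real.pi))) :=
          mul_le_mul hp1 hb (norm_nonneg _) zero_le_one
      _ = _ := one_mul _
  have hsplit : ((cI N L r (labF N L) + cI N L r (labB N L) : ℝ) : ℂ) * J =
      ((cI N L r (labF N L) : ℝ) : ℂ) * J + ((cI N L r (labB N L) : ℝ) : ℂ) * J := by push_cast; ring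
  rw [hsplit]
  calc ‖((cI N L r (labF N L) : ℝ) : ℂ) * J + ((cI N L r (labB N L) : ℝ) : ℂ) * J‖
      ≤ ‖((cI N L r (labF N L) : ℝ) : ℂ) * J‖ + ‖((cI N L r (labB N L) : ℝ) : ℂ) * J‖ := norm_add_le _ _
    _ ≤ Acst / 2 * (Real.sqrt Real.pi / Real.sqrt (2 * Real.pi)) + Acst / 2 * (Real.sqrt Real.pi / Real.sqrt (2 * Real.pi)) :=
        add_le_add (hterm _) (hterm _)
    _ = Acst * (Real.sqrt Real.pi / Real.sqrt (2 * Real.pi)) := by ring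
    _ < 1 := by nlinarith

open Classical in
/-- **S53's ATTACHED-PART QUANTITY IS NOT ZERO ON THE DATUM** [decided toy] (W24's `exp_locE_cube` BY NAME + `actI_live`). [folklore] -/
theorem recordEnd_live (hr0 : 0 < r) (k : ℕ) :
    locE (TTouch (d := 4) (N := N)) (fun Z : (tsys 4 N).Dom => Z.1) (actI N L r hr k 1) (X₀ N).1 ≠
      locE (TTouch (d := 4) (N := N)) (fun Z : (tsys 4 N).Dom => Z.1) (actI N L r hr k 0) (X₀ N).1 := by
  intro h
  have h1 := exp_locE_cube N (w := actI N L r hr k 1) (norm_actI_X₀_lt_one N L r hr k (by simp))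
  have h0 := exp_locE_cube N (w := actI N L r hr k 0) (norm_actI_X₀_lt_one N L r hr k (by simp))
  rw [X₀_val] at h
  have h' := congrArg cexp h
  rw [h1, h0, add_right_inj] at h'
  exact actI_live N L r hr hr0 k h'

open Classical in
/-- **S53's μ-PART QUANTITY IS NOT ZERO ON THE DATUM** at any real source `0 < t ≤ 1` inside the window [decided toy]. [folklore] -/
theorem recordMuEnd_live (hr0 : 0 < r) {t : ℝ} (ht0 : 0 < t) (ht1 : t ≤ 1) (k : ℕ) :
    locE (TTouch (d := 4) (N := N)) (fun Z : (tsys 4 N).Dom => Z.1) (actI N L r hr k t) (X₀ N).1 ≠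
      locE (TTouch (d := 4) (N := N)) (fun Z : (tsys 4 N).Dom => Z.1) (actI N L r hr k 0) (X₀ N).1 := by
  intro h
  have hts : ‖(t : ℂ)‖ ≤ 2 := by rw [Complex.norm_real, Real.norm_of_nonneg ht0.le]; linarith
  have h1 := exp_locE_cube N (w := actI N L r hr k t) (norm_actI_X₀_lt_one N L r hr k hts)
  have h0 := exp_locE_cube N (w := actI N L r hr k 0) (norm_actI_X₀_lt_one N L r hr k (by simp))
  rw [X₀_val] at h
  have h' := congrArg cexp h
  rw [h1, h0, add_right_inj] at h'
  exact actI_mu_live N L r hr hr0 ht0 k h'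

open Classical in
/-- **BOTH ENDs FIRE ON A LIVE, STRICTLY-REFINED DATUM** (`3 ≤ L`, `0 < r`, real source `t = 1∕2`): S53's attached bound, S53's μ bound,
both quantities non-zero, and W71's strict `hmono` — all on the same datum. [folklore] -/
example (hL : 3 ≤ L) (hr0 : 0 < r) (k : ℕ) :
    ‖locE (TTouch (d := 4) (N := N)) (fun Z : (tsys 4 N).Dom => Z.1) (actI N L r hr k 1) (X₀ N).1 -
          locE (TTouch (d := 4) (N := N)) (fun Z : (tsys 4 N).Dom => Z.1) (actI N L r hr k 0) (X₀ N).1‖ ≤ K₀ 64 8 ∧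
      ‖locE (TTouch (d := 4) (N := N)) (fun Z : (tsys 4 N).Dom => Z.1) (actI N L r hr k ((1 / 2 : ℝ) : ℂ)) (X₀ N).1 -
          locE (TTouch (d := 4) (N := N)) (fun Z : (tsys 4 N).Dom => Z.1) (actI N L r hr k 0) (X₀ N).1‖ ≤ K₀ 64 8 ∧
      locE (TTouch (d := 4) (N := N)) (fun Z : (tsys 4 N).Dom => Z.1) (actI N L r hr k 1) (X₀ N).1 ≠
        locE (TTouch (d := 4) (N := N)) (fun Z : (tsys 4 N).Dom => Z.1) (actI N L r hr k 0) (X₀ N).1 ∧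
      locE (TTouch (d := 4) (N := N)) (fun Z : (tsys 4 N).Dom => Z.1) (actI N L r hr k ((1 / 2 : ℝ) : ℂ)) (X₀ N).1 ≠
        locE (TTouch (d := 4) (N := N)) (fun Z : (tsys 4 N).Dom => Z.1) (actI N L r hr k 0) (X₀ N).1 ∧
      torusTreeLen (X₀ N).1 < torusTreeLen (blk N L).1 :=
  ⟨recordEnd_fires_closed N L r hr k,
    recordMuEnd_fires_closed N L r hr k (by rw [Complex.norm_real]; norm_num),
    recordEnd_live N L r hr hr0 k, recordMuEnd_live N L r hr hr0 (by norm_num) (by norm_num) k, hmono_strict N L hL⟩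

end Torus

end Summit.QuantumFields.BalabanUV.T4Continuum.NE1p.DressedSmallFieldRecordLabelsTorusWitness

end
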